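import Summits.AnomalousDissipation.AnomalousDissipation.Theorems.SolenoidalFractalHomogenisationLagrangianStepSidebandXResidual
import Summits.AnomalousDissipation.AnomalousDissipation.Theorems.SolenoidalFractalHomogenisationLagrangianStepSidebandXDefectSum
import Summits.AnomalousDissipation.AnomalousDissipation.Theorems.SolenoidalFractalHomogenisationLagrangianStepSidebandXDefectSmall
import Summits.AnomalousDissipation.AnomalousDissipation.Theorems.SolenoidalFractalHomogenisationLagrangianStepSidebandResponseTransversal
import Summits.AnomalousDissipation.AnomalousDissipation.Theorems.SolenoidalFractalHomogenisationLagrangianStepSidebandResponseExtContinuous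
import Summits.AnomalousDissipation.AnomalousDissipation.Theorems.SolenoidalFractalHomogenisationLagrangianStepRightGronwall
import HarnessLib

/-!
# V0 (`stub_D1_V0`) — T4c-3d SKELETON: the residual energy of THE weak solution has right derivative `≤ −(π²lo/2)‖r‖² + G(t)`
# (crux workfile `Lines/onelevel_V0_energy.lean`; sorries ONLY in the named steps; prover seat `ad-k1l-cellLawV-w1` g6)

This is the TYPED TARGET of brick T4c-3d of `Lines/onelevel-V0-residual.md` §3–§4, for the successor of the w1 lineage.  Everything it quotes is LANDED
(p688035 … p695052, 18 files); the steps `step_*` below are the remaining Young bookkeeping, each a direct combination of the quoted lemmas.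
Objects (n ≥ 1, 2|ℓ| ≤ n, every ±mⱼ retained, reference data = psiStar's: tensor `𝔸`, `γ₁ = 1`):
`Z t = sbVec W₁ n ((1/n²)•𝔸) F w ℓ R t`, `x t = modeRep … ℓ t`, `Nⱼ = responseExt W₁ 𝔸 1 R j`, `ξⱼ = (xiCoeff W₁ n ℓ j : ℂ)`, `y t = Σⱼ ξⱼ • Nⱼ t (x t)`,
`r t = Z t − projX n ℓ R (y t)`.  NOT a proof of `stub_D1_V0`, of K1L_D, or of AD.
-/

set_option linter.dupNamespace false

noncomputable section

namespace Summit.AnomalousDissipation.AnomalousDissipation.Cruxes.LagrangianRenormalisationStepDesign.V0Energy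

open Set MeasureTheory Complex UnitAddTorus Filter Topology
open scoped InnerProductSpace
open Literature.Analysis Literature.Analysis.FunctionSpaces Literature.Analysis.FunctionSpaces.Torus
open Literature.Analysis.FluidPDE Literature.Analysis.FluidPDE.Torus Literature.Analysis.FluidPDE.LatticeShear
open Summit.AnomalousDissipation.AnomalousDissipation.Theorems.SolenoidalFractalHomogenisation.LagrangianStep.Sideband
open Summit.AnomalousDissipation.AnomalousDissipation.Theorems.SolenoidalFractalHomogenisation.LagrangianStep.CellChain (modeRep)

variable {k₀ : ℕ}

/-- The reference state `y t = Σⱼ ξⱼ • Nⱼ t (x t)`. -/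
def refState (W₁ : LatticeWord k₀) (n : ℕ) (ℓ : Fin 3 → ℤ) (𝔸 : Torus.Visc4 (Fin 3)) (R : ℕ)
    (F : UnitAddTorus (Fin 3) → EuclideanSpace ℝ (Fin 3)) (w : ℝ → UnitAddTorus (Fin 3) → EuclideanSpace ℝ (Fin 3)) (t : ℝ) : Space R :=
  ∑ j, ((xiCoeff W₁ n ℓ j : ℝ) : ℂ) • responseExt W₁ 𝔸 1 R j t (modeRep W₁ n ((1 / (n : ℝ) ^ 2) • 𝔸) F w ℓ t)

/-- The residual `r t = Z t − projX (y t)`. -/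
def residual (W₁ : LatticeWord k₀) (n : ℕ) (ℓ : Fin 3 → ℤ) (𝔸 : Torus.Visc4 (Fin 3)) (R : ℕ)
    (F : UnitAddTorus (Fin 3) → EuclideanSpace ℝ (Fin 3)) (w : ℝ → UnitAddTorus (Fin 3) → EuclideanSpace ℝ (Fin 3)) (t : ℝ) : Space R :=
  sbVec W₁ n ((1 / (n : ℝ) ^ 2) • 𝔸) F w ℓ R t - projX n ℓ R (refState W₁ n ℓ 𝔸 R F w t)

/-- **STEP (transversality of the reference state)**: `projX 1 0 R (y t) = y t` — from `projX_responseExt` by linearity. -/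
theorem step_refState_transversal (W₁ : LatticeWord k₀) {n : ℕ} (ℓ : Fin 3 → ℤ) {𝔸 : Torus.Visc4 (Fin 3)} {lo hi : ℝ}
    (h𝔸 : Torus.NearIso 𝔸 lo hi) (hlo : 0 < lo) (R : ℕ)
    (F : UnitAddTorus (Fin 3) → EuclideanSpace ℝ (Fin 3)) (w : ℝ → UnitAddTorus (Fin 3) → EuclideanSpace ℝ (Fin 3)) (t : ℝ) :
    projX 1 0 R (refState W₁ n ℓ 𝔸 R F w t) = refState W₁ n ℓ 𝔸 R F w t := by
  have hj : ∀ j, projX 1 0 R (((xiCoeff W₁ n ℓ j : ℝ) : ℂ) • responseExt W₁ 𝔸 1 R j t (modeRep W₁ n ((1 / (n : ℝ) ^ 2) • 𝔸) F w ℓ t))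
      = ((xiCoeff W₁ n ℓ j : ℝ) : ℂ) • responseExt W₁ 𝔸 1 R j t (modeRep W₁ n ((1 / (n : ℝ) ^ 2) • 𝔸) F w ℓ t) := fun j => by
    rw [ContinuousLinearMap.map_smul, projX_responseExt W₁ h𝔸 hlo one_pos j t]
  simp only [refState, map_sum, hj]

/-- `residual` unfolds to the function of `hasDerivWithinAt_residual`. -/
theorem residual_eq (W₁ : LatticeWord k₀) (n : ℕ) (ℓ : Fin 3 → ℤ) (𝔸 : Torus.Visc4 (Fin 3)) (R : ℕ)
    (F : UnitAddTorus (Fin 3) → EuclideanSpace ℝ (Fin 3)) (w : ℝ → UnitAddTorus (Fin 3) → EuclideanSpace ℝ (Fin 3)) :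
    residual W₁ n ℓ 𝔸 R F w = fun τ => sbVec W₁ n ((1 / (n : ℝ) ^ 2) • 𝔸) F w ℓ R τ -
      projX n ℓ R (∑ j, ((xiCoeff W₁ n ℓ j : ℝ) : ℂ) • responseExt W₁ 𝔸 1 R j τ (modeRep W₁ n ((1 / (n : ℝ) ^ 2) • 𝔸) F w ℓ τ)) := rfl

/-- **STEP (the residual equation, instantiated)**: `r' = genX t r + Def t` within `Ici t`, with psiStar's reference data — direct from
`hasDerivWithinAt_residual` + `hasDerivWithinAt_responseExt` (`isPeriodicResponse_response_of_nearIso … one_pos`). -/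
theorem step_residual_eq (W₁ : LatticeWord k₀) {n : ℕ} {T : ℝ} {𝔸 : Torus.Visc4 (Fin 3)} {lo hi : ℝ} (h𝔸 : Torus.NearIso 𝔸 lo hi) (hlo : 0 < lo)
    {F : UnitAddTorus (Fin 3) → EuclideanSpace ℝ (Fin 3)} {w : ℝ → UnitAddTorus (Fin 3) → EuclideanSpace ℝ (Fin 3)}
    (h : Torus.IsWeakTensorPassiveVectorOn 0 T ((1 / (n : ℝ) ^ 2) • 𝔸) (W₁.cell n) F w) (hF : Integrable F volume) (ℓ : Fin 3 → ℤ) {R : ℕ}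
    (hbox : ∀ j, (W₁.phase j).m ∈ box R) {t : ℝ} (ht : t ∈ Ioo 0 T) :
    HasDerivWithinAt
      (fun τ => sbVec W₁ n ((1 / (n : ℝ) ^ 2) • 𝔸) F w ℓ R τ -
        projX n ℓ R (∑ j, ((xiCoeff W₁ n ℓ j : ℝ) : ℂ) • responseExt W₁ 𝔸 1 R j τ (modeRep W₁ n ((1 / (n : ℝ) ^ 2) • 𝔸) F w ℓ τ)))
      (genX W₁ n ℓ ((1 / (n : ℝ) ^ 2) • 𝔸) 1 R t
          (sbVec W₁ n ((1 / (n : ℝ) ^ 2) • 𝔸) F w ℓ R t -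
            projX n ℓ R (∑ j, ((xiCoeff W₁ n ℓ j : ℝ) : ℂ) • responseExt W₁ 𝔸 1 R j t (modeRep W₁ n ((1 / (n : ℝ) ^ 2) • 𝔸) F w ℓ t))) +
        ((genX W₁ n ℓ ((1 / (n : ℝ) ^ 2) • 𝔸) 1 R t
              (projX n ℓ R (∑ j, ((xiCoeff W₁ n ℓ j : ℝ) : ℂ) • responseExt W₁ 𝔸 1 R j t (modeRep W₁ n ((1 / (n : ℝ) ^ 2) • 𝔸) F w ℓ t))) -
            projX n ℓ R (gen W₁ 𝔸 1 R t
              (∑ j, ((xiCoeff W₁ n ℓ j : ℝ) : ℂ) • responseExt W₁ 𝔸 1 R j t (modeRep W₁ n ((1 / (n : ℝ) ^ 2) • 𝔸) F w ℓ t)))) +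
          ∑ j, ((xiCoeff W₁ n ℓ j : ℝ) : ℂ) •
            (sourceX W₁ n ℓ R j t (modeRep W₁ n ((1 / (n : ℝ) ^ 2) • 𝔸) F w ℓ t) -
              projX n ℓ R (source W₁ R j t (modeRep W₁ n ((1 / (n : ℝ) ^ 2) • 𝔸) F w ℓ t))) -
          projX n ℓ R (∑ j, ((xiCoeff W₁ n ℓ j : ℝ) : ℂ) • responseExt W₁ 𝔸 1 R j t
            (-(((4 * Real.pi ^ 2 : ℝ) : ℂ) • transversalProj ℓ (Torus.symbT (Torus.majorTranspose ((1 / (n : ℝ) ^ 2) • 𝔸)) ℓ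
                (modeRep W₁ n ((1 / (n : ℝ) ^ 2) • 𝔸) F w ℓ t))) -
              ∑ j', ((xiCoeff W₁ n ℓ j' : ℝ) : ℂ) • transversalProj ℓ (feedback W₁ R j' t (sbVec W₁ n ((1 / (n : ℝ) ^ 2) • 𝔸) F w ℓ R t)))) +
          tailVec W₁ n ((1 / (n : ℝ) ^ 2) • 𝔸) F w ℓ R t)) (Ici t) t := by
  have hN : ∀ j, IsPeriodicResponse W₁ 𝔸 1 R j (response W₁ 𝔸 1 R j) := fun j => isPeriodicResponse_response_of_nearIso W₁ h𝔸 hlo one_pos R j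
  exact hasDerivWithinAt_residual W₁ n h hF ℓ 1 hbox ht (fun j => hasDerivWithinAt_responseExt W₁ 𝔸 1 R j (hN j) t)

open Classical in
/-- The outside-tail energy at time `t`: `Σ_{z ∈ box} (Σⱼ ‖αⱼ‖(‖[z−mⱼ ∉ box∪{0}]·y(k_{z−mⱼ},t)‖ + ‖[z+mⱼ ∉ box∪{0}]·y(k_{z+mⱼ},t)‖))²` (only class modes
OUTSIDE the box within `max|mⱼ|` of its boundary enter; its time integral is `O(E₀/(lo·n²·R²))` by the dissipation integral of `exists_energyRep_cell`). -/
def tailEnergy (W₁ : LatticeWord k₀) (n : ℕ) (ℓ : Fin 3 → ℤ) (𝔸 : Torus.Visc4 (Fin 3)) (R : ℕ)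
    (F : UnitAddTorus (Fin 3) → EuclideanSpace ℝ (Fin 3)) (w : ℝ → UnitAddTorus (Fin 3) → EuclideanSpace ℝ (Fin 3)) (t : ℝ) : ℝ :=
  ∑ z : box R, (∑ j, ‖slotAmp W₁ j‖ *
    (‖(if (z.1 - (W₁.phase j).m ∉ box R ∧ z.1 - (W₁.phase j).m ≠ 0) then
        modeRep W₁ n ((1 / (n : ℝ) ^ 2) • 𝔸) F w (classFreq n ℓ (z.1 - (W₁.phase j).m)) t else 0)‖ +
     ‖(if (z.1 + (W₁.phase j).m ∉ box R ∧ z.1 + (W₁.phase j).m ≠ 0) then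
        modeRep W₁ n ((1 / (n : ℝ) ^ 2) • 𝔸) F w (classFreq n ℓ (z.1 + (W₁.phase j).m)) t else 0)‖)) ^ 2

/-- **TARGET T4c-3d (energy inequality of the residual with explicit source; constants uniform in `n, ℓ, R, t, T`, datum and solution)**.
For the successor: with `ξ := √|ℓ|²/n`, there is `C = C(W₁, lo, hi, β) ≥ 0` such that for every cell number `n ≥ 1`, slow mode with `2|ℓ| ≤ n`,
truncation retaining every `±mⱼ`, weak solution and `t ∈ (0,T)`, the right derivative `φ` of `‖r‖²` (`r = residual …`, see `residual_eq`) exists and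
`φ ≤ −(π²·lo/2)·‖r t‖² + C·(ξ²‖y t‖² + ξ⁴‖x t‖² + ξ⁴‖Z t‖² + tailEnergy t)` (`y = refState`, `x = modeRep ℓ`, `Z = sbVec`).
Route: `two_inner_genX_add_le` (+ `residual_transversal`) gives `φ ≤ −𝒟(r) + 2⟪r, Def⟫` with `𝒟(r) = 8π²(lo/n²)Σ|k_z|²‖r_z‖² ≥ 2π²lo‖r‖²`
(`|k_z| ≥ n|z|/2 ≥ n/2`); split `2⟪r,Def⟫` by `real_inner_space_eq_sum` and `genX_projX_sub_projX_gen_apply` (augmentation remainder = 0 by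
`step_refState_transversal`); THE WHOLE GROUP D1 IS LANDED: `…SidebandXDefectD1.two_real_inner_D1_le` (p695052):
`2⟪r, D1⟫_ℝ ≤ ¼𝒟(r) + (32π²534²K₀²/lo)ξ²‖y‖² + 4(Σⱼ2π‖αⱼ‖(5+3|mⱼ|))ξ‖r‖‖y‖` (then Young `4cξ‖r‖‖y‖ ≤ (σ/12)‖r‖² + (48c²/σ)ξ²‖y‖²`, `σ = 2π²lo`); D2: `norm_sourceX_sub_projX_source_le`; D3:
`norm_slowRHS_le` + `norm_responseExt_le` (+ `‖projX v‖ ≤ ‖v‖`); D4: `two_abs_re_inner_tail_le` with `ε = 2π²lo/n²` (= `¼𝒟`). -/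
theorem todo_residual_energy_ineq (W₁ : LatticeWord k₀) {lo hi β : ℝ} (hlo : 0 < lo) (hhi : 0 ≤ hi) (hβ : 0 ≤ β) :
    ∃ C : ℝ, 0 ≤ C ∧ ∀ {n : ℕ}, n ≠ 0 → ∀ {𝔸 : Torus.Visc4 (Fin 3)}, Torus.NearIso 𝔸 lo hi → Torus.OddSmall 𝔸 β →
      ∀ {T : ℝ} {F : UnitAddTorus (Fin 3) → EuclideanSpace ℝ (Fin 3)} {w : ℝ → UnitAddTorus (Fin 3) → EuclideanSpace ℝ (Fin 3)},
      Torus.IsWeakTensorPassiveVectorOn 0 T ((1 / (n : ℝ) ^ 2) • 𝔸) (W₁.cell n) F w → Integrable F volume →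
      ∀ {ℓ : Fin 3 → ℤ}, 2 * Real.sqrt (freqNormSq ℓ) ≤ n → ∀ {R : ℕ}, (∀ j, (W₁.phase j).m ∈ box R) →
      ∀ {t : ℝ}, t ∈ Ioo 0 T →
        ∃ φ : ℝ, HasDerivWithinAt (fun τ => ‖residual W₁ n ℓ 𝔸 R F w τ‖ ^ 2) φ (Ici t) t ∧
          φ ≤ -(Real.pi ^ 2 * lo / 2) * ‖residual W₁ n ℓ 𝔸 R F w t‖ ^ 2 +
            C * ((Real.sqrt (freqNormSq ℓ) / n) ^ 2 * ‖refState W₁ n ℓ 𝔸 R F w t‖ ^ 2 +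
                 (Real.sqrt (freqNormSq ℓ) / n) ^ 4 * ‖modeRep W₁ n ((1 / (n : ℝ) ^ 2) • 𝔸) F w ℓ t‖ ^ 2 +
                 (Real.sqrt (freqNormSq ℓ) / n) ^ 4 * ‖sbVec W₁ n ((1 / (n : ℝ) ^ 2) • 𝔸) F w ℓ R t‖ ^ 2 +
                 tailEnergy W₁ n ℓ 𝔸 R F w t) := by
  sorry

end Summit.AnomalousDissipation.AnomalousDissipation.Cruxes.LagrangianRenormalisationStepDesign.V0Energy

end
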